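import Summits.ResolutionOfSingularities.ResolutionOfSingularities.Theorems.EquisingularLiftEquisingularLiftNatEmbeddedInfinitesimalLiftOfCharts
import Literature.AlgebraicGeometry.Resolution.StrictTransformIsBlowup
import HarnessLib

/-!
# [OURS · L1 W4.5(b) · EL♮(3) · (T-k) · J1c brick B4, chart dictionary D1] The kernel of the transition `Wₙ ↪ Wₙ₊₁` on an affine chart is `JA'`

Crux EL♮(3) = stmt-ResolutionOfSingularities-20148; J1 = `EmbeddedInfinitesimalLiftFact` (p596985) ⟸ `EmbeddedInfinitesimalChartLiftFact` (p603689).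
Written by res-L1-w45b-stub-4 g10 (brick B4 = (λ♯) of `L/res-type-027/J1c-DESIGN-v2.md` §2, 5a0a95bce22e50fb; desk R5 (ii)). OURS; NOT a statement of
H. Hironaka's 2017 manuscript; AI-written, weaker than expert review. No `sorry`; standard axioms; DEF-FREE.
`--supports stmt-ResolutionOfSingularities-20148 --as helper`.

WHAT (the first entry of the affine dictionary the chart-local lift (λ♯) needs):
* `ker_app_eq_map_of_isPullback_specMap` — for a cartesian square `t ≫ p = q ≫ Spec φ` of schemes over `Spec φ : Spec S → Spec R` with `φ`
  SURJECTIVE and an affine open `U ⊆ X'`: `ker (t.app U) = (ker φ)·Γ(X', U)` (the ideal of `R` extended along `Γ(Spec R, ⊤) → Γ(X', U)`):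
  `t.ker = (Spec φ).ker.comap p` (Mathlib `ker_fst_of_isClosedImmersion` through `IsPullback.isoPullback`), chart values by
  `Resolution.ideal_comap_eq_map_of_le` (Görtz–Wedhorn I Ex. 4.36) and `Scheme.Hom.ker_apply`, `(Spec φ).ker(⊤) = ker φ` by `ΓSpecIso` naturality.
* `isPullback_transition` — the transition `Wₙ → Wₙ₊₁` of infinitesimal neighbourhoods is the base change of
  `Spec (A ⧸ Iⁿ⁺¹) → Spec (A ⧸ Iⁿ⁺²)` along `Wₙ₊₁ → Spec (A ⧸ Iⁿ⁺²)` (pasting `IsPullback.of_right`).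
* `ker_app_transition_eq_map` — hence on an affine chart `U ⊆ Wₙ₊₁`: `ker ((transition n).app U) = (Iⁿ⁺¹/Iⁿ⁺²)·Γ(Wₙ₊₁, U)`.
[cite: GortzWedhorn2020, Example 4.36 (p. 139)]
-/

set_option linter.dupNamespace false

noncomputable section

open CategoryTheory CategoryTheory.Limits AlgebraicGeometry TopologicalSpace
open Literature.AlgebraicGeometry.Morphisms (infinitesimalNeighbourhood)
open Literature.AlgebraicGeometry.Resolution

namespace Summit.ResolutionOfSingularities.ResolutionOfSingularities.Cruxes.EquisingularLiftNat.Sections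

/-- **Kernel of a base-changed closed immersion on a chart.** For a cartesian square `t ≫ p = q ≫ Spec.map φ` with `φ : R → S` surjective and an
affine open `U ⊆ X'`: `ker (t.app U) = (ker φ, read in Γ(Spec R, ⊤))·Γ(X', U)`, the extension along `p.appLE ⊤ U`. [cite: GortzWedhorn2020, Example 4.36 (p. 139)]
[folklore] -/
theorem ker_app_eq_map_of_isPullback_specMap {X X' : Scheme.{0}} {R S : CommRingCat.{0}} (φ : R ⟶ S)
    (hφ : Function.Surjective φ.hom) {t : X ⟶ X'} {q : X ⟶ Spec S} {p : X' ⟶ Spec R} (H : IsPullback t q p (Spec.map φ))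
    (U : X'.affineOpens) :
    RingHom.ker (t.app (U : X'.Opens)).hom =
      ((RingHom.ker φ.hom).comap (Scheme.ΓSpecIso R).hom.hom).map (p.appLE ⊤ U le_top).hom := by
  haveI : IsClosedImmersion (Spec.map φ) := IsClosedImmersion.spec_of_surjective _ hφ
  haveI : IsClosedImmersion t := MorphismProperty.IsStableUnderBaseChange.of_isPullback H.flip inferInstance
  -- `t.ker = (Spec φ).ker.comap p`
  have hker : t.ker = (Spec.map φ).ker.comap p := by
    rw [← Scheme.IdealSheafData.ker_fst_of_isClosedImmersion (Spec.map φ) p, ← H.isoPullback_hom_fst, Scheme.Hom.ker_comp_of_isIso]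
  -- chart values
  have h1 : t.ker.ideal U = RingHom.ker (t.app (U : X'.Opens)).hom := Scheme.Hom.ker_apply t U
  have h2 : ((Spec.map φ).ker.comap p).ideal U =
      (((Spec.map φ).ker).ideal ⟨⊤, isAffineOpen_top (Spec R)⟩).map (p.appLE ⊤ U le_top).hom :=
    ideal_comap_eq_map_of_le p (Spec.map φ).ker ⟨⊤, isAffineOpen_top (Spec R)⟩ U le_top
  have h3 : ((Spec.map φ).ker).ideal ⟨⊤, isAffineOpen_top (Spec R)⟩ = (RingHom.ker φ.hom).comap (Scheme.ΓSpecIso R).hom.hom := by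
    rw [Scheme.Hom.ker_apply (Spec.map φ) ⟨⊤, isAffineOpen_top (Spec R)⟩]
    change RingHom.ker (Spec.map φ).appTop.hom = _
    -- `(Spec φ).appTop = ΓSpecIso R ≫ φ ≫ (ΓSpecIso S)⁻¹`
    have hnat : (Spec.map φ).appTop = (Scheme.ΓSpecIso R).hom ≫ φ ≫ (Scheme.ΓSpecIso S).inv := by
      rw [← Category.assoc, ← Scheme.ΓSpecIso_naturality φ, Category.assoc, Iso.hom_inv_id, Category.comp_id]
    have hinj : Function.Injective (Scheme.ΓSpecIso S).inv.hom := (ConcreteCategory.bijective_of_isIso (Scheme.ΓSpecIso S).inv).1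
    rw [hnat]
    ext x
    simp only [RingHom.mem_ker, Ideal.mem_comap, CommRingCat.hom_comp, RingHom.comp_apply]
    constructor
    · intro hx
      exact hinj (by rw [hx, map_zero])
    · intro hx
      rw [hx, map_zero]
  rw [← h1, hker, h2, h3]

/-- **The transition is a base change**: `Wₙ = Wₙ₊₁ ×_{Spec (A ⧸ Iⁿ⁺²)} Spec (A ⧸ Iⁿ⁺¹)` with first projection the transition map (pasting).
[folklore] -/
theorem isPullback_transition {A : Type} [CommRing A] (I : Ideal A) {X : Scheme.{0}} (f : X ⟶ Spec (.of A)) (n : ℕ) :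
    IsPullback (infinitesimalNeighbourhood.transition I f n) (infinitesimalNeighbourhood.toSpec I f n)
      (infinitesimalNeighbourhood.toSpec I f (n + 1)) (Spec.map (CommRingCat.ofHom (infinitesimalNeighbourhood.transitionRingHom I n))) := by
  have big : IsPullback (infinitesimalNeighbourhood.transition I f n ≫ infinitesimalNeighbourhood.ι I f (n + 1))
      (infinitesimalNeighbourhood.toSpec I f n) f
      (Spec.map (CommRingCat.ofHom (infinitesimalNeighbourhood.transitionRingHom I n)) ≫ infinitesimalNeighbourhood.base I (n + 1)) := by
    rw [infinitesimalNeighbourhood.transition_ι, infinitesimalNeighbourhood.specMap_transitionRingHom_comp_base]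
    exact IsPullback.of_hasPullback f (infinitesimalNeighbourhood.base I n)
  exact big.of_right (infinitesimalNeighbourhood.transition_toSpec I f n) (IsPullback.of_hasPullback f (infinitesimalNeighbourhood.base I (n + 1)))

/-- **D1. On an affine chart `U ⊆ Wₙ₊₁` the kernel of the transition is the extended ideal `(Iⁿ⁺¹/Iⁿ⁺²)·Γ(Wₙ₊₁, U)`.** [folklore] -/
theorem ker_app_transition_eq_map {A : Type} [CommRing A] (I : Ideal A) {X : Scheme.{0}} (f : X ⟶ Spec (.of A)) (n : ℕ)
    (U : (infinitesimalNeighbourhood I f (n + 1)).affineOpens) :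
    RingHom.ker ((infinitesimalNeighbourhood.transition I f n).app (U : (infinitesimalNeighbourhood I f (n + 1)).Opens)).hom =
      ((RingHom.ker (infinitesimalNeighbourhood.transitionRingHom I n)).comap
          (Scheme.ΓSpecIso (.of (A ⧸ I ^ (n + 2)))).hom.hom).map
        ((infinitesimalNeighbourhood.toSpec I f (n + 1)).appLE ⊤ U le_top).hom :=
  ker_app_eq_map_of_isPullback_specMap (CommRingCat.ofHom (infinitesimalNeighbourhood.transitionRingHom I n))
    (fun y => by obtain ⟨x, rfl⟩ := Ideal.Quotient.mk_surjective y; exact ⟨Ideal.Quotient.mk _ x, rfl⟩)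
    (isPullback_transition I f n) U

end Summit.ResolutionOfSingularities.ResolutionOfSingularities.Cruxes.EquisingularLiftNat.Sections

end
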